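import Literature.Analysis.FluidPDE.PassiveVectorVarTensorLionsExistence
import Literature.Analysis.FluidPDE.PassiveVectorVarTensorUniqueness
import HarnessLib

/-!
# Well-posedness of the VARIABLE-tensor passive-vector class in `L²ₜH¹ₓ`: energy inequality and uniqueness

Analysis/FluidPDE file (everything proved; no definitions, no named facts). The class
`Torus.IsWeakVarTensorPassiveVectorOn 0 T 𝔹 b w₀ w` (`PassiveVectorVarTensor`) of weak solutions of
`∂ₜw + (b·∇)w + ∇π = ∇·(𝔹(t,y)∇w)`, `∇·w = 0` on `T^d × (0,T)`, read together with the `L²ₜH¹ₓ` regularity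
produced by Lions' theorem (`PassiveVectorVarTensorLionsExistence`):

* `IsWeakVarTensorPassiveVectorOn.memLp_two_uncurry` — class members are in `L²(μ_T)` (`L^∞_t L²_x` on a
  bounded interval);
* `IsWeakVarTensorPassiveVectorOn.weak_eq_prod` — the weak identity of the class (iterated integrals,
  `A = 0`) in product-measure form (Fubini; bounded carrier, `𝔹` with smooth slices, `𝔹`, `∂_y𝔹` jointly
  continuous);
* `integrableOn_dissipation` — the dissipation `τ ↦ ∫ Σ 𝔹(τ)_{icle} (G c)_i (G e)_l` of an `L²(μ_T)` gradient is
  integrable on `(0,T)`;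
* `IsWeakVarTensorPassiveVectorOn.ae_eq_of_hasWeakPartialDeriv` — **uniqueness in the class among solutions
  with a weak space gradient in `L²(μ_T)`** (`NearIso 𝔸 lo hi`, `|𝔹 − 𝔸| ≤ δ`, `(card d)²δ ≤ lo`);
* `exists_isWeakVarTensorPassiveVectorOn_energy` — **existence with the ENERGY IDENTITY and the sharp ENERGY
  INEQUALITY** `∫‖w(t)‖² + 2(lo − (card d)²δ) ∫_{(0,t]} Σ_c‖∂_c w‖₂² ≤ ‖w₀‖²` for a.e. `t`
  (Lions–Magenes 1972, Chap. 3, Thm. 1.1/1.2 and §4.4 (4.20)–(4.21); Temam 1984, Ch. III §1 Thm. 1.1).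

## References

* J.-L. Lions, E. Magenes, *Non-homogeneous boundary value problems and applications* I (1972), Chap. 3,
  Thm. 1.1, Thm. 1.2, §4.4. [`LionsMagenes1972`]
* R. Temam, *Navier–Stokes Equations*, 3rd ed. (1984), Ch. III §1, Thm. 1.1. [`Temam1984`]
-/

noncomputable section

open MeasureTheory Set Filter Function TopologicalSpace
open scoped ENNReal NNReal InnerProductSpace Topology

namespace Literature.Analysis.FluidPDE

namespace Torus

variable {d : Type*} [Fintype d] [DecidableEq d]

section ClassTools

variable {A T : ℝ} {𝔹 : ℝ → UnitAddTorus d → Visc4 d} {b w : ℝ → UnitAddTorus d → EuclideanSpace ℝ d}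
  {w₀ : UnitAddTorus d → EuclideanSpace ℝ d}

/-- **Class members are in `L²(μ_T)`**: `w ∈ L^∞(0,T; L²)` measurable on `(0,T) × T^d` is in
`L²((0,T) × T^d)` (Tonelli; `T` finite). [cite: LionsMagenes1972, Chap. 3 §4.3] -/
theorem IsWeakVarTensorPassiveVectorOn.memLp_two_uncurry (h : IsWeakVarTensorPassiveVectorOn A T 𝔹 b w₀ w) :
    MemLp (uncurry w) 2 (((volume : Measure ℝ).restrict (Ioo 0 T)).prod volume) := by
  obtain ⟨C, hC⟩ := h.ae_lintegral_sq_le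
  have hm := h.aestronglyMeasurable_uncurry
  refine ⟨hm, ?_⟩
  rw [eLpNorm_lt_top_iff_lintegral_rpow_enorm_lt_top two_ne_zero ENNReal.ofNat_ne_top, ENNReal.toReal_ofNat]
  have e : ∫⁻ p, ‖uncurry w p‖ₑ ^ (2 : ℝ) ∂(((volume : Measure ℝ).restrict (Ioo 0 T)).prod volume) =
      ∫⁻ p, ‖uncurry w p‖ₑ ^ 2 ∂(((volume : Measure ℝ).restrict (Ioo 0 T)).prod volume) :=
    lintegral_congr fun p => by rw [ENNReal.rpow_two]
  rw [e, lintegral_prod _ (hm.enorm.pow_const 2)]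
  calc ∫⁻ t in Ioo 0 T, ∫⁻ x, ‖uncurry w (t, x)‖ₑ ^ 2
      ≤ ∫⁻ _ in Ioo 0 T, (C : ℝ≥0∞) := lintegral_mono_ae (hC.mono fun t ht => ht)
    _ < ⊤ := by
        rw [lintegral_const, Measure.restrict_apply_univ]
        exact ENNReal.mul_lt_top ENNReal.coe_lt_top measure_Ioo_lt_top

/-- **The weak identity of the class in product-measure form** (`A = 0`): for a class member, a bounded
carrier (`‖b‖ ≤ M` a.e. on `(0,T) × T^d`) and a coefficient field with smooth slices, `𝔹`, `∂_y𝔹` jointly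
continuous, `∫_{μ_T} ⟪w, ∂ₜΨ + (b·∇)Ψ + 𝓛^{𝔹(t),*}Ψ⟫ + ∫⟪w₀, Ψ(0)⟫ = 0` for every divergence-free space–time
test `Ψ` (Fubini on the integrable weak integrand). [cite: LionsMagenes1972, Chap. 3 §4.3] -/
theorem IsWeakVarTensorPassiveVectorOn.weak_eq_prod (h : IsWeakVarTensorPassiveVectorOn 0 T 𝔹 b w₀ w)
    (h𝔹s : ∀ t i c j e, FunctionSpaces.Torus.IsSmooth (fun y => 𝔹 t y i c j e))
    (h𝔹c : ∀ i c j e, Continuous (uncurry fun t y => 𝔹 t y i c j e))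
    (h𝔹d : ∀ i c j e e', Continuous (uncurry fun t y =>
      FunctionSpaces.Torus.partialDeriv e' (fun y => 𝔹 t y i c j e) y))
    {M : ℝ} (hbM : ∀ᵐ p ∂(((volume : Measure ℝ).restrict (Ioo 0 T)).prod (volume : Measure (UnitAddTorus d))),
      ‖uncurry b p‖ ≤ M)
    {Ψ : ℝ → UnitAddTorus d → EuclideanSpace ℝ d} (hΨ : FunctionSpaces.Torus.IsSpaceTimeTest T Ψ)
    (hΨdiv : ∀ t, FunctionSpaces.Torus.IsDivFree (Ψ t)) :
    (∫ p, ⟪w p.1 p.2, FunctionSpaces.Torus.timeDeriv Ψ p.1 p.2 +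
        FunctionSpaces.Torus.convect (b p.1) (Ψ p.1) p.2 + viscAdjVar (𝔹 p.1) (Ψ p.1) p.2⟫_ℝ
        ∂(((volume : Measure ℝ).restrict (Ioo 0 T)).prod volume)) + ∫ x, ⟪w₀ x, Ψ 0 x⟫_ℝ = 0 := by
  have hw2 := h.memLp_two_uncurry
  have hbm := h.aestronglyMeasurable_uncurry_carrier
  have hOp : MemLp (fun p : ℝ × UnitAddTorus d => FunctionSpaces.Torus.timeDeriv Ψ p.1 p.2 +
      FunctionSpaces.Torus.convect (b p.1) (Ψ p.1) p.2 + viscAdjVar (𝔹 p.1) (Ψ p.1) p.2) 2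
      (((volume : Measure ℝ).restrict (Ioo 0 T)).prod volume) := by
    refine ((memLp_two_dampedOpVar h𝔹s h𝔹c h𝔹d hΨ hbm hbM).add hΨ.memLp_two_uncurry).ae_eq
      (ae_of_all _ fun p => ?_)
    simp only [Pi.add_apply, Function.uncurry]
    abel
  have hint : Integrable (fun p : ℝ × UnitAddTorus d => ⟪w p.1 p.2, FunctionSpaces.Torus.timeDeriv Ψ p.1 p.2 +
      FunctionSpaces.Torus.convect (b p.1) (Ψ p.1) p.2 + viscAdjVar (𝔹 p.1) (Ψ p.1) p.2⟫_ℝ)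
      (((volume : Measure ℝ).restrict (Ioo 0 T)).prod volume) :=
    (hw2.norm.integrable_mul hOp.norm).mono' (hw2.aestronglyMeasurable.inner hOp.aestronglyMeasurable)
      (ae_of_all _ fun p => norm_inner_le_norm (uncurry w p) _)
  have key := h.weak_eq Ψ hΨ hΨdiv
  simp only [zero_mul, add_zero] at key
  rw [integral_prod _ hint]
  exact key

end ClassTools

omit [DecidableEq d] in
/-- **The dissipation of an `L²(μ_T)` gradient is integrable in time**: for `𝔹` jointly continuous with
`|𝔹| ≤ B` and `(t,x) ↦ G t c x ∈ L²(μ_T)`, `τ ↦ ∫ Σ_{l,i,c,e} 𝔹(τ,x)_{icle} (G τ c x)_i (G τ e x)_l` is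
integrable on `(0,T)`, with the pointwise bound by `Σ B ‖G τ c‖‖G τ e‖`. [cite: LionsMagenes1972, Chap. 3 §4.4] -/
theorem integrableOn_dissipation {T : ℝ} {𝔹 : ℝ → UnitAddTorus d → Visc4 d}
    (h𝔹c : ∀ i c j e, Continuous (uncurry fun t y => 𝔹 t y i c j e)) {B : ℝ}
    (hB : ∀ t y i c j e, |𝔹 t y i c j e| ≤ B) {G : ℝ → d → UnitAddTorus d → EuclideanSpace ℝ d}
    (hG2 : ∀ c, MemLp (uncurry (G · c)) 2 (((volume : Measure ℝ).restrict (Ioo 0 T)).prod volume)) :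
    Integrable (fun p : ℝ × UnitAddTorus d => ∑ l, ∑ i, ∑ c, ∑ e, 𝔹 p.1 p.2 i c l e * (G p.1 c p.2) i * (G p.1 e p.2) l)
      (((volume : Measure ℝ).restrict (Ioo 0 T)).prod volume) ∧
    IntegrableOn (fun τ => ∫ x, ∑ l, ∑ i, ∑ c, ∑ e, 𝔹 τ x i c l e * (G τ c x) i * (G τ e x) l) (Ioo 0 T) := by
  have hH : Integrable (fun p : ℝ × UnitAddTorus d => ∑ l, ∑ i, ∑ c, ∑ e, 𝔹 p.1 p.2 i c l e * (G p.1 c p.2) i * (G p.1 e p.2) l)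
      (((volume : Measure ℝ).restrict (Ioo 0 T)).prod volume) := by
    refine integrable_finsetSum _ fun l _ => integrable_finsetSum _ fun i _ =>
      integrable_finsetSum _ fun c _ => integrable_finsetSum _ fun e _ => ?_
    refine Integrable.mono' (((hG2 c).norm.integrable_mul (hG2 e).norm).const_mul B)
      ((((h𝔹c i c l e).aestronglyMeasurable).mul
        ((PiLp.continuous_apply 2 _ i).comp_aestronglyMeasurable (hG2 c).1)).mul
        ((PiLp.continuous_apply 2 _ l).comp_aestronglyMeasurable (hG2 e).1)) (ae_of_all _ fun p => ?_)
    rw [Real.norm_eq_abs, abs_mul, abs_mul]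
    show |𝔹 p.1 p.2 i c l e| * |(G p.1 c p.2) i| * |(G p.1 e p.2) l| ≤ B * (‖G p.1 c p.2‖ * ‖G p.1 e p.2‖)
    calc |𝔹 p.1 p.2 i c l e| * |(G p.1 c p.2) i| * |(G p.1 e p.2) l| ≤ B * ‖G p.1 c p.2‖ * ‖G p.1 e p.2‖ :=
          mul_le_mul (mul_le_mul (hB p.1 p.2 i c l e) (FunctionSpaces.Torus.abs_apply_le_norm (G p.1 c p.2) i) (abs_nonneg _)
            ((abs_nonneg _).trans (hB p.1 p.2 i c l e))) (FunctionSpaces.Torus.abs_apply_le_norm (G p.1 e p.2) l) (abs_nonneg _)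
            (mul_nonneg ((abs_nonneg _).trans (hB p.1 p.2 i c l e)) (norm_nonneg _))
      _ = B * (‖G p.1 c p.2‖ * ‖G p.1 e p.2‖) := by ring
  exact ⟨hH, hH.integral_prod_left⟩

omit [DecidableEq d] in
/-- Single entries are dominated by the sum of all absolute entries. [folklore] -/
private theorem abs_entry_le_sum_V8 (𝔸 : Visc4 d) (i c j e : d) :
    |𝔸 i c j e| ≤ ∑ i', ∑ c', ∑ j', ∑ e', |𝔸 i' c' j' e'| := by
  calc |𝔸 i c j e| ≤ ∑ e', |𝔸 i c j e'| :=
        Finset.single_le_sum (f := fun e' => |𝔸 i c j e'|) (fun _ _ => abs_nonneg _) (Finset.mem_univ e)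
    _ ≤ ∑ j', ∑ e', |𝔸 i c j' e'| :=
        Finset.single_le_sum (f := fun j' => ∑ e', |𝔸 i c j' e'|) (fun _ _ => by positivity) (Finset.mem_univ j)
    _ ≤ ∑ c', ∑ j', ∑ e', |𝔸 i c' j' e'| :=
        Finset.single_le_sum (f := fun c' => ∑ j', ∑ e', |𝔸 i c' j' e'|) (fun _ _ => by positivity) (Finset.mem_univ c)
    _ ≤ ∑ i', ∑ c', ∑ j', ∑ e', |𝔸 i' c' j' e'| :=
        Finset.single_le_sum (f := fun i' => ∑ c', ∑ j', ∑ e', |𝔸 i' c' j' e'|) (fun _ _ => by positivity) (Finset.mem_univ i)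

section WellPosed

variable {T : ℝ} {𝔸 : Visc4 d} {𝔹 : ℝ → UnitAddTorus d → Visc4 d}
  {b : ℝ → UnitAddTorus d → EuclideanSpace ℝ d} {w₀ : UnitAddTorus d → EuclideanSpace ℝ d}

/-- **Uniqueness in the class among `L²ₜH¹ₓ` solutions.** Two members of
`IsWeakVarTensorPassiveVectorOn 0 T 𝔹 b w₀` (same bounded carrier, same coefficient field with
`NearIso 𝔸 lo hi`, `|𝔹 − 𝔸| ≤ δ`, `0 ≤ δ`, `(card d)²δ ≤ lo`, same datum `w₀ ∈ L²`), each with a weak space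
gradient in `L²(μ_T)`, coincide a.e. on `(0,T) × T^d`. [cite: LionsMagenes1972, Chap. 3 Thm. 1.2] -/
theorem IsWeakVarTensorPassiveVectorOn.ae_eq_of_hasWeakPartialDeriv {lo hi : ℝ} (h𝔸 : NearIso 𝔸 lo hi)
    (h𝔹s : ∀ t i c j e, FunctionSpaces.Torus.IsSmooth (fun y => 𝔹 t y i c j e))
    (h𝔹c : ∀ i c j e, Continuous (uncurry fun t y => 𝔹 t y i c j e))
    (h𝔹d : ∀ i c j e e', Continuous (uncurry fun t y =>
      FunctionSpaces.Torus.partialDeriv e' (fun y => 𝔹 t y i c j e) y))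
    {δ : ℝ} (hδ0 : 0 ≤ δ) (hδ : ∀ t y i c j e, |𝔹 t y i c j e - 𝔸 i c j e| ≤ δ)
    (hlo : (Fintype.card d : ℝ) ^ 2 * δ ≤ lo) {M : ℝ} (hM : 0 ≤ M)
    (hbM : ∀ᵐ p ∂(((volume : Measure ℝ).restrict (Ioo 0 T)).prod (volume : Measure (UnitAddTorus d))), ‖uncurry b p‖ ≤ M)
    {w₁ w₂ : ℝ → UnitAddTorus d → EuclideanSpace ℝ d} {G₁ G₂ : ℝ → d → UnitAddTorus d → EuclideanSpace ℝ d}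
    (h₁ : IsWeakVarTensorPassiveVectorOn 0 T 𝔹 b w₀ w₁) (h₂ : IsWeakVarTensorPassiveVectorOn 0 T 𝔹 b w₀ w₂)
    (hG₁ : ∀ᵐ t ∂(volume.restrict (Ioo 0 T)), ∀ c, FunctionSpaces.Torus.HasWeakPartialDeriv c (w₁ t) (G₁ t c))
    (hG₂ : ∀ᵐ t ∂(volume.restrict (Ioo 0 T)), ∀ c, FunctionSpaces.Torus.HasWeakPartialDeriv c (w₂ t) (G₂ t c))
    (hG₁2 : ∀ c, MemLp (uncurry (G₁ · c)) 2 (((volume : Measure ℝ).restrict (Ioo 0 T)).prod volume))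
    (hG₂2 : ∀ c, MemLp (uncurry (G₂ · c)) 2 (((volume : Measure ℝ).restrict (Ioo 0 T)).prod volume)) :
    uncurry w₁ =ᵐ[((volume : Measure ℝ).restrict (Ioo 0 T)).prod volume] uncurry w₂ :=
  ae_eq_of_weakVar (w₀ := w₀) h𝔸 h𝔹s h𝔹c h𝔹d hδ0 hδ hlo h₁.aestronglyMeasurable_uncurry_carrier hM hbM
    h₁.ae_isWeaklyDivFree_carrier h₁.memLp_two_uncurry h₂.memLp_two_uncurry h₁.ae_isWeaklyDivFree h₂.ae_isWeaklyDivFree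
    hG₁ hG₂ hG₁2 hG₂2 (fun _ hΨ hΨdiv => h₁.weak_eq_prod h𝔹s h𝔹c h𝔹d hbM hΨ hΨdiv)
    (fun _ hΨ hΨdiv => h₂.weak_eq_prod h𝔹s h𝔹c h𝔹d hbM hΨ hΨdiv)

set_option maxHeartbeats 800000 in
/-- **Existence with the energy identity and the sharp energy inequality.** Under the hypotheses of
`exists_isWeakVarTensorPassiveVectorOn` (`T > 0`, `NearIso 𝔸 lo hi`, `𝔹` with smooth slices, `𝔹`, `∂_y𝔹`
jointly continuous, `|𝔹 − 𝔸| ≤ δ`, `0 ≤ δ`, `(card d)²δ < lo`, `b ∈ L^∞` weakly divergence free for a.e. `t`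
with essential bound `M ≥ 0`, `w₀ ∈ L²` weakly divergence free) there are a weak solution `w` in the class
and a weak space gradient `G` of it in `L²(μ_T)` such that, for a.e. `t ∈ (0,T)`,
`∫‖w(t)‖² = ‖w₀‖² − 2∫_{(0,t]}∫ Σ 𝔹 ∇w·∇w` (energy identity) and
`∫‖w(t)‖² + 2(lo − (card d)²δ) ∫_{(0,t]} ∫ Σ_c ‖G τ c‖² ≤ ‖w₀‖²` (energy inequality).
[cite: LionsMagenes1972, Chap. 3 Thm. 1.1 and §4.4 (4.20)–(4.21)] -/
theorem exists_isWeakVarTensorPassiveVectorOn_energy (hT : 0 < T) {lo hi : ℝ} (h𝔸 : NearIso 𝔸 lo hi)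
    (h𝔹s : ∀ t i c j e, FunctionSpaces.Torus.IsSmooth (fun y => 𝔹 t y i c j e))
    (h𝔹c : ∀ i c j e, Continuous (uncurry fun t y => 𝔹 t y i c j e))
    (h𝔹d : ∀ i c j e e', Continuous (uncurry fun t y =>
      FunctionSpaces.Torus.partialDeriv e' (fun y => 𝔹 t y i c j e) y))
    {δ : ℝ} (hδ0 : 0 ≤ δ) (hδ : ∀ t y i c j e, |𝔹 t y i c j e - 𝔸 i c j e| ≤ δ)
    (hlo : (Fintype.card d : ℝ) ^ 2 * δ < lo)
    (hb : MemLp (FunctionSpaces.Torus.stLift b) ∞ (volume.restrict (Ioo 0 T ×ˢ univ)))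
    (hbdiv : ∀ᵐ t ∂(volume.restrict (Ioo 0 T)), FunctionSpaces.Torus.IsWeaklyDivFree (b t))
    {M : ℝ} (hM : 0 ≤ M)
    (hbM : ∀ᵐ p ∂(((volume : Measure ℝ).restrict (Ioo 0 T)).prod (volume : Measure (UnitAddTorus d))),
      ‖uncurry b p‖ ≤ M)
    (hw₀ : MemLp w₀ 2 volume) (hdiv₀ : FunctionSpaces.Torus.IsWeaklyDivFree w₀) :
    ∃ (w : ℝ → UnitAddTorus d → EuclideanSpace ℝ d) (G : ℝ → d → UnitAddTorus d → EuclideanSpace ℝ d),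
      IsWeakVarTensorPassiveVectorOn 0 T 𝔹 b w₀ w ∧
      MemLp (uncurry w) 2 (((volume : Measure ℝ).restrict (Ioo 0 T)).prod volume) ∧
      (∀ c, MemLp (uncurry (G · c)) 2 (((volume : Measure ℝ).restrict (Ioo 0 T)).prod volume)) ∧
      (∀ᵐ t ∂(volume.restrict (Ioo 0 T)), MemLp (w t) 2 volume ∧
        ∀ c, MemLp (G t c) 2 volume ∧ FunctionSpaces.Torus.HasWeakPartialDeriv c (w t) (G t c)) ∧
      (∀ᵐ t ∂(volume.restrict (Ioo 0 T)),
        ∫ x, ‖w t x‖ ^ 2 = (∫ x, ‖w₀ x‖ ^ 2) -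
          2 * ∫ τ in Ioc 0 t, ∫ x, ∑ l, ∑ i, ∑ c, ∑ e, 𝔹 τ x i c l e * (G τ c x) i * (G τ e x) l) ∧
      (∀ᵐ t ∂(volume.restrict (Ioo 0 T)),
        (∫ x, ‖w t x‖ ^ 2) + 2 * (lo - (Fintype.card d : ℝ) ^ 2 * δ) * ∫ τ in Ioc 0 t, ∫ x, ∑ c, ‖G τ c x‖ ^ 2 ≤
          ∫ x, ‖w₀ x‖ ^ 2) := by
  obtain ⟨w, G, hcl, hw2, hG2, hreg, -⟩ := exists_isWeakVarTensorPassiveVectorOn hT h𝔸 h𝔹s h𝔹c h𝔹d hδ0 hδ hlo hb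
    hbdiv hM hbM hw₀ hdiv₀
  have hbm := hcl.aestronglyMeasurable_uncurry_carrier
  -- a bound for the entries of `𝔹`
  set B : ℝ := δ + ∑ i, ∑ c, ∑ j, ∑ e, |𝔸 i c j e| with hBdef
  have hB0 : 0 ≤ B := add_nonneg hδ0 (by positivity)
  have hB : ∀ t y i c j e, |𝔹 t y i c j e| ≤ B := by
    intro t y i c j e
    calc |𝔹 t y i c j e| = |(𝔹 t y i c j e - 𝔸 i c j e) + 𝔸 i c j e| := by rw [sub_add_cancel]
      _ ≤ |𝔹 t y i c j e - 𝔸 i c j e| + |𝔸 i c j e| := abs_add_le _ _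
      _ ≤ δ + ∑ i', ∑ c', ∑ j', ∑ e', |𝔸 i' c' j' e'| := add_le_add (hδ t y i c j e) (abs_entry_le_sum_V8 𝔸 i c j e)
  have hweak : ∀ Ψ : ℝ → UnitAddTorus d → EuclideanSpace ℝ d, FunctionSpaces.Torus.IsSpaceTimeTest T Ψ →
      (∀ t, FunctionSpaces.Torus.IsDivFree (Ψ t)) →
      (∫ p, ⟪w p.1 p.2, FunctionSpaces.Torus.timeDeriv Ψ p.1 p.2 +
          FunctionSpaces.Torus.convect (b p.1) (Ψ p.1) p.2 + viscAdjVar (𝔹 p.1) (Ψ p.1) p.2⟫_ℝ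
          ∂(((volume : Measure ℝ).restrict (Ioo 0 T)).prod volume)) + ∫ x, ⟪w₀ x, Ψ 0 x⟫_ℝ = 0 :=
    fun _ hΨ hΨdiv => hcl.weak_eq_prod h𝔹s h𝔹c h𝔹d hbM hΨ hΨdiv
  have hw2s : ∀ᵐ t ∂(volume.restrict (Ioo 0 T)), MemLp (w t) 2 volume := hreg.mono fun t ht => ht.1
  have hGw : ∀ᵐ t ∂(volume.restrict (Ioo 0 T)), ∀ c, FunctionSpaces.Torus.HasWeakPartialDeriv c (w t) (G t c) :=
    hreg.mono fun t ht c => (ht.2 c).2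
  have hGws : ∀ᵐ t ∂(volume.restrict (Ioo 0 T)), ∀ c, MemLp (G t c) 2 volume := hreg.mono fun t ht c => (ht.2 c).1
  have hE := ae_integral_norm_sq_eq_of_weakVar h𝔹s h𝔹c h𝔹d hB0 hB hw2 hw2s hcl.ae_isWeaklyDivFree hGw hG2 hbm hM hbM
    hbdiv hweak hw₀ hdiv₀
  refine ⟨w, G, hcl, hw2, hG2, hreg, hE, ?_⟩
  -- the sharp energy inequality: Gårding under the time integral
  set lo' : ℝ := lo - (Fintype.card d : ℝ) ^ 2 * δ with hlo'
  have hDI := (integrableOn_dissipation (T := T) h𝔹c hB hG2).2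
  have hGsum : Integrable (fun p : ℝ × UnitAddTorus d => ∑ c, ‖uncurry (G · c) p‖ ^ 2)
      (((volume : Measure ℝ).restrict (Ioo 0 T)).prod volume) :=
    integrable_finsetSum _ fun c _ => (hG2 c).integrable_norm_pow two_ne_zero
  have hGnI : IntegrableOn (fun τ => ∫ x, ∑ c, ‖G τ c x‖ ^ 2) (Ioo 0 T) := hGsum.integral_prod_left
  have hGa : ∀ᵐ τ ∂(volume.restrict (Ioo 0 T)),
      lo' * ∫ x, ∑ c, ‖G τ c x‖ ^ 2 ≤ ∫ x, ∑ l, ∑ i, ∑ c, ∑ e, 𝔹 τ x i c l e * (G τ c x) i * (G τ e x) l := by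
    filter_upwards [hreg, hcl.ae_isWeaklyDivFree] with τ hτ hdw
    exact integral_sum_entry_mul_self_ge h𝔸 (h𝔹s τ) (hδ τ) (hB τ) hτ.1 hdw (fun c => (hτ.2 c).2) (fun c => (hτ.2 c).1)
  have hGa' : ∀ᵐ τ ∂(volume : Measure ℝ), τ ∈ Ioo 0 T →
      lo' * ∫ x, ∑ c, ‖G τ c x‖ ^ 2 ≤ ∫ x, ∑ l, ∑ i, ∑ c, ∑ e, 𝔹 τ x i c l e * (G τ c x) i * (G τ e x) l :=
    (ae_restrict_iff' measurableSet_Ioo).1 hGa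
  filter_upwards [hE, ae_restrict_mem measurableSet_Ioo] with t ht htI
  have hsub : Ioc 0 t ⊆ Ioo 0 T := Ioc_subset_Ioo_right htI.2
  have hmono : ∫ τ in Ioc 0 t, lo' * ∫ x, ∑ c, ‖G τ c x‖ ^ 2 ≤
      ∫ τ in Ioc 0 t, ∫ x, ∑ l, ∑ i, ∑ c, ∑ e, 𝔹 τ x i c l e * (G τ c x) i * (G τ e x) l :=
    integral_mono_ae ((hGnI.mono_set hsub).const_mul lo') (hDI.mono_set hsub)
      ((ae_restrict_iff' measurableSet_Ioc).2 (hGa'.mono fun τ hτ hτI => hτ (hsub hτI)))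
  rw [integral_const_mul] at hmono
  rw [ht]
  linarith

end WellPosed

end Torus

end Literature.Analysis.FluidPDE

end
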